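import Literature.IUT.LogVolume.TensorPacketFactorIso
import Literature.IUT.LogVolume.TensorPacketShell
import Literature.IUT.LogVolume.TensorPacketHull
import Literature.IUT.LogVolume.LocalUnitLogEquivariance
import HarnessLib

/-!
# Tensor packets along FACTORWISE isometric field isomorphisms, II: the log-shell lattice, the hull and the
# chosen-decomposition log-measure `log μ̄` are transported ([IUTchIII] Prop. 3.9 (ii); Dupuy–Hilado §4)

Sequel (abc-iut cell, seat abc-iut-w5-d056) to abc-iut-w5-d178's `TensorPacketFactorIso.lean`: there, for a
family of ISOMETRIC `ℚ_p`-algebra isomorphisms `φ_i : k_i ⥲ k'_i` of fields of the MLF class, the induced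
`ℚ_p`-algebra isomorphism `Φ = ⊗ φ_i : ⊗ k_i ⥲ ⊗ k'_i` (`factorAlgEquiv`) is shown to carry `R_I` onto `R'_I`,
`(R_I)^∼` onto `(R'_I)^∼` and the INTRINSIC log-volume `μ^log` to `μ^log` ([IUTchIII] Prop. 3.9 (ii)
"Mono-analytic Compatibility", kurims p. 116: the packet log-volumes "may be constructed via a functorial
algorithm from the `𝒟^⊢`-prime-strips"; [IUTchIV] Prop. 1.4 (i) p. 13). HERE the remaining objects of the
`−|log(Θ)|` computation are transported along the same `Φ`:

* `image_logPacket_factor` — **`Φ(log_p(R_I^×)) = log_p(R'_I^×)`** (the generating pure tensors `⊗ z_i`,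
  `z_i ∈ log_p(R_i^×)`, correspond because an isometric field isomorphism commutes with `log_p`,
  abc-iut-w5-d242's `LocalUnitLogEquivariance.image_logUnits`), hence `image_logShell_factor`:
  **`Φ(I_{v⃗}) = I'_{v⃗}`** for the log-shell `I = (2p)^{−|I|}·log_p(R_I^×)` (Dupuy–Hilado §4 intro);
* `image_packetHull_factor` — **`Φ(hull(S)) = hull(Φ(S))`** for EVERY `S` (the hull is the `(R_I)^∼`-span,
  [IUTchIII] Rmk. 3.9.5 (i) / Dupuy–Hilado Rmk. 4.12.1, and `Φ` is a ring isomorphism with `Φ((R_I)^∼) =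
  (R'_I)^∼`);
* `packetVol_image_factor`, `packetAdm_image_factor`, `packetLogμ_image_factor` — the CHOSEN-DECOMPOSITION
  normalised Haar measure and log-measure `log μ̄` of abc-iut-c312-3's `TensorPacketMeasure.lean` (the ones the
  cell's `−|log(Θ)|` numbers are built from) satisfy **`log μ̄'(Φ(A)) = log μ̄(A)` for EVERY subset `A`**
  (conjugating by the two decompositions gives a `ℚ_p`-linear isomorphism `⊕ L ⥲ ⊕ L'` carrying unit polydisc
  to unit polydisc; same `ℚ_p`-dimension) — the `packetLogμ`-side twin of w5-d178's `tensorLogVolume_image_factor`,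
  with NO positivity/finiteness hypothesis;
* the headline invariants: `packetLogμ_packetHull_image_factor` (`log μ̄'(hull(Φ S)) = log μ̄(hull S)`) and
  **`packetLogμ_packetHull_logShell_factor`: `log μ̄'(hull(I'_{v⃗})) = log μ̄(hull(I_{v⃗}))`** — the hull-volume
  `H` of the log-shell (the `δ_Λ`-carrying term of abc-iut-w5-d082's `TensorPacketContentVolume`) depends on
  the packet only through the ISOMETRY CLASSES of its factors.

Consumer: the per-summand Galois invariance needed to DESCEND a `V(K)`-indexed packet average to the section
`V̲ ≅ V_mod` ([IUTchI] Rmk. 3.1.5 `K/F_mod` Galois; `WeightDescentExpectation.lean`, with the factor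
isomorphisms `RescaledCompletion.galAlgEquiv` of `RescaledCompletionGaloisTransport.lean`). Everything is a
theorem of Mathlib's `PiTensorProduct` / Haar measure in campaign-S vocabulary; PROOF-ONLY (no definitions,
no named facts); nothing here bears on the disputed [IUTchIII] Cor. 3.12 or takes a side; typed ≠ endorsed.
[cite: Mochizuki2012, IUTchIII Prop. 3.9 (ii) p. 116] [cite: Mochizuki2012, IUTchIV Prop. 1.4 (i) p. 13]
[cite: DupuyHilado2025, §4 (intro), §4.7, Rmk. 4.12.1]
-/

noncomputable section

open MeasureTheory Set Metric Module
open scoped TensorProduct NormedField Pointwise ENNReal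

namespace Literature.IUT.LogVolume

variable (p : ℕ) [Fact p.Prime]
variable {I : Type} [Fintype I] [DecidableEq I]
variable (k : I → Type) [∀ i, NontriviallyNormedField (k i)] [∀ i, NormedAlgebra ℚ_[p] (k i)]
  [∀ i, IsUltrametricDist (k i)] [∀ i, ProperSpace (k i)]
variable (k' : I → Type) [∀ i, NontriviallyNormedField (k' i)] [∀ i, NormedAlgebra ℚ_[p] (k' i)]
  [∀ i, IsUltrametricDist (k' i)] [∀ i, ProperSpace (k' i)]
variable (φ : ∀ i, k i ≃ₐ[ℚ_[p]] k' i)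

/-! ## 1. `Φ(log_p(R_I^×)) = log_p(R'_I^×)` and the log-shell -/

section Lattice

omit [Fintype I] [DecidableEq I] in
/-- The generating pure tensors `⊗ z_i`, `z_i ∈ log_p(R_i^×)`, of `log_p(R_I^×)` correspond under `Φ = ⊗ φ_i` for
ISOMETRIC `φ_i` (`φ_i(log_p(R_i^×)) = log_p(R'_i^×)`, `LocalUnitLogEquivariance.image_logUnits`).
[cite: Mochizuki2012, IUTchIV Prop. 1.2 p. 10] [cite: DupuyHilado2025, §4 (intro)] -/
theorem image_logPacket_generators_factor (hφ : ∀ i (x : k i), ‖φ i x‖ = ‖x‖) :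
    factorAlgEquiv p k k' φ '' {t | ∃ z : Π i, k i, (∀ i, z i ∈ logUnits (k i)) ∧ t = purePacket p k z} =
      {t | ∃ z' : Π i, k' i, (∀ i, z' i ∈ logUnits (k' i)) ∧ t = purePacket p k' z'} := by
  have himg : ∀ i, (φ i).toRingEquiv '' logUnits (k i) = logUnits (k' i) :=
    fun i => image_logUnits p (φ i).toRingEquiv (hφ i)
  ext t
  constructor
  · rintro ⟨_, ⟨z, hz, rfl⟩, rfl⟩
    refine ⟨fun i => φ i (z i), fun i => ?_, factorAlgEquiv_purePacket p k k' φ z⟩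
    rw [← himg i]
    exact ⟨z i, hz i, rfl⟩
  · rintro ⟨z', hz', rfl⟩
    have hex : ∀ i, ∃ z : k i, z ∈ logUnits (k i) ∧ φ i z = z' i := fun i => by
      have := hz' i
      rw [← himg i] at this
      obtain ⟨z, hz, hzz'⟩ := this
      exact ⟨z, hz, hzz'⟩
    choose z hz hzz' using hex
    refine ⟨purePacket p k z, ⟨z, hz, rfl⟩, ?_⟩
    rw [factorAlgEquiv_purePacket]
    exact congrArg (purePacket p k') (funext hzz')

omit [Fintype I] [DecidableEq I] in
/-- **`Φ(log_p(R_I^×)) = log_p(R'_I^×)`**: an additive isomorphism maps the subgroup generated by a set onto the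
subgroup generated by its image. [cite: Mochizuki2012, IUTchIV Prop. 1.2 p. 10] [cite: DupuyHilado2025, §4 (intro)] -/
theorem image_logPacket_factor (hφ : ∀ i (x : k i), ‖φ i x‖ = ‖x‖) :
    factorAlgEquiv p k k' φ '' (logPacket p k : Set (PacketAlgebra p k)) = logPacket p k' := by
  have h := AddMonoidHom.map_closure
    ((factorAlgEquiv p k k' φ : PacketAlgebra p k ≃ₐ[ℚ_[p]] PacketAlgebra p k') :
      PacketAlgebra p k →+ PacketAlgebra p k')
    {t | ∃ z : Π i, k i, (∀ i, z i ∈ logUnits (k i)) ∧ t = purePacket p k z}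
  have h' := congrArg (fun H : AddSubgroup (PacketAlgebra p k') => (H : Set (PacketAlgebra p k'))) h
  simp only [AddSubgroup.coe_map] at h'
  rw [logPacket, logPacket, ← image_logPacket_generators_factor p k k' φ hφ]
  exact h'

omit [Fintype I] [DecidableEq I] [∀ i, IsUltrametricDist (k i)] [∀ i, ProperSpace (k i)]
  [∀ i, IsUltrametricDist (k' i)] [∀ i, ProperSpace (k' i)] in
/-- `Φ` commutes with scalars on subsets: `Φ(c·A) = c·Φ(A)`. [cite: DupuyHilado2025, §4.7] -/
theorem image_const_smul_factor (c : ℚ_[p]) (A : Set (PacketAlgebra p k)) :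
    factorAlgEquiv p k k' φ '' (c • A) = c • factorAlgEquiv p k k' φ '' A := by
  rw [← image_smul, ← image_smul, image_image, image_image]
  exact image_congr fun a _ => by rw [map_smul]

omit [DecidableEq I] in
/-- **`Φ(I_{v⃗}) = I'_{v⃗}`** for the log-shells `I = (2p)^{−|I|}·log_p(R_I^×)`, `I' = (2p)^{−|I|}·log_p(R'_I^×)`.
[cite: DupuyHilado2025, §4 (intro)] -/
theorem image_logShell_factor (hφ : ∀ i (x : k i), ‖φ i x‖ = ‖x‖) :
    factorAlgEquiv p k k' φ '' logShell p k = logShell p k' := by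
  rw [logShell, logShell, image_const_smul_factor, image_logPacket_factor p k k' φ hφ]

end Lattice

/-! ## 2. `Φ(hull(S)) = hull(Φ(S))` -/

section Hull

variable [Nonempty I]

omit [DecidableEq I] in
/-- `Φ` maps the `(R_I)^∼`-span of `S` INTO the `(R'_I)^∼`-span of `Φ(S)` (`Φ` is a ring homomorphism with
`Φ((R_I)^∼) ⊆ (R'_I)^∼`). [cite: Mochizuki2012, IUTchIII Rmk. 3.9.5 (i) p. 127] [cite: DupuyHilado2025, Rmk. 4.12.1] -/
theorem image_packetHull_subset_factor (S : Set (PacketAlgebra p k)) :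
    factorAlgEquiv p k k' φ '' packetHull p k S ⊆ packetHull p k' (factorAlgEquiv p k k' φ '' S) := by
  rintro _ ⟨x, hx, rfl⟩
  rw [packetHull_apply, SetLike.mem_coe] at hx
  rw [packetHull_apply, SetLike.mem_coe]
  induction hx using Submodule.span_induction with
  | mem x hx => exact Submodule.subset_span ⟨x, hx, rfl⟩
  | zero => rw [map_zero]; exact Submodule.zero_mem _
  | add x y _ _ hx hy => rw [map_add]; exact Submodule.add_mem _ hx hy
  | smul r x _ hx =>
    have hr : factorAlgEquiv p k k' φ (r : PacketAlgebra p k) ∈ normalizedPacket p k' := by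
      have : factorAlgEquiv p k k' φ (r : PacketAlgebra p k) ∈
          factorAlgEquiv p k k' φ '' (normalizedPacket p k : Set (PacketAlgebra p k)) := ⟨r, r.2, rfl⟩
      rwa [image_normalizedPacket_factor] at this
    have hsmul : factorAlgEquiv p k k' φ (r • x) =
        (⟨_, hr⟩ : normalizedPacket p k') • factorAlgEquiv p k k' φ x := by
      rw [Subring.smul_def, Subring.smul_def, smul_eq_mul, smul_eq_mul, map_mul]
    rw [hsmul]
    exact Submodule.smul_mem _ _ hx

omit [DecidableEq I] in
/-- **`Φ(hull(S)) = hull(Φ(S))`** for every subset `S` of the packet: the holomorphic hull (the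
`(R_I)^∼`-span, [IUTchIII] Rmk. 3.9.5 (i); "the smallest possible module containing this regions",
Dupuy–Hilado Rmk. 4.12.1) is transported along `Φ = ⊗ φ_i`, a ring isomorphism with `Φ((R_I)^∼) = (R'_I)^∼`.
[cite: Mochizuki2012, IUTchIII Rmk. 3.9.5 (i) p. 127] [cite: DupuyHilado2025, Rmk. 4.12.1] -/
theorem image_packetHull_factor (S : Set (PacketAlgebra p k)) :
    factorAlgEquiv p k k' φ '' packetHull p k S = packetHull p k' (factorAlgEquiv p k k' φ '' S) := by
  refine Subset.antisymm (image_packetHull_subset_factor p k k' φ S) ?_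
  -- the image of the span is itself an `(R'_I)^∼`-submodule containing `Φ(S)`
  let M : Submodule (normalizedPacket p k') (PacketAlgebra p k') :=
    { carrier := factorAlgEquiv p k k' φ '' packetHull p k S
      zero_mem' := ⟨0, by rw [packetHull_apply, SetLike.mem_coe]; exact Submodule.zero_mem _, map_zero _⟩
      add_mem' := by
        rintro _ _ ⟨x, hx, rfl⟩ ⟨y, hy, rfl⟩
        rw [packetHull_apply, SetLike.mem_coe] at hx hy
        exact ⟨x + y, by rw [packetHull_apply, SetLike.mem_coe]; exact Submodule.add_mem _ hx hy, map_add _ _ _⟩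
      smul_mem' := by
        rintro r' _ ⟨x, hx, rfl⟩
        rw [packetHull_apply, SetLike.mem_coe] at hx
        -- `r' = Φ r` for some `r ∈ (R_I)^∼`
        have hr' : (r' : PacketAlgebra p k') ∈
            factorAlgEquiv p k k' φ '' (normalizedPacket p k : Set (PacketAlgebra p k)) := by
          rw [image_normalizedPacket_factor]; exact r'.2
        obtain ⟨r, hr, hrr'⟩ := hr'
        refine ⟨(⟨r, hr⟩ : normalizedPacket p k) • x, ?_, ?_⟩
        · rw [packetHull_apply, SetLike.mem_coe]; exact Submodule.smul_mem _ _ hx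
        · rw [Subring.smul_def, Subring.smul_def, smul_eq_mul, smul_eq_mul, map_mul]
          exact congrArg (· * _) hrr' }
  change (packetSpan p k' (factorAlgEquiv p k k' φ '' S) : Set (PacketAlgebra p k')) ⊆ (M : Set (PacketAlgebra p k'))
  exact Submodule.span_le.mpr (image_mono (subset_packetHull p k S))

end Hull

/-! ## 3. The chosen-decomposition measure `μ`, admissibility and `log μ̄` are transported -/

section Volume

variable [Nonempty I]

omit [DecidableEq I] [∀ i, IsUltrametricDist (k i)] [∀ i, IsUltrametricDist (k' i)] [Nonempty I] in
include φ in
/-- The two packets have the same degree `D = dim_{ℚ_p}`. [cite: Mochizuki2012, IUTchIV Prop. 1.4 (i) p. 13] -/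
theorem packetDegree_factor_eq : packetDegree p (DFac p k') = packetDegree p (DFac p k) := by
  rw [packetDegree_dFac_eq, packetDegree_dFac_eq, finrank_factor_eq p k k' φ]

omit [DecidableEq I] [∀ i, IsUltrametricDist (k i)] [∀ i, IsUltrametricDist (k' i)] [Nonempty I] in
/-- The conjugate `ψ' ∘ Φ ∘ ψ⁻¹ : ⊕ L ≃ ⊕ L'` applied to `ψ(A)` is `ψ'(Φ(A))`. [cite: DupuyHilado2025, §4.7] -/
private theorem image_conj_factor (A : Set (PacketAlgebra p k)) :
    ((dEquiv p k).toLinearEquiv.symm.trans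
        ((factorAlgEquiv p k k' φ).toLinearEquiv.trans (dEquiv p k').toLinearEquiv)) '' (dEquiv p k '' A) =
      dEquiv p k' '' (factorAlgEquiv p k k' φ '' A) := by
  rw [image_image, image_image]
  refine image_congr fun a _ => ?_
  simp

/-- **`μ'(Φ(A)) = μ(A)` for every `A`**: the normalised (at the unit polydiscs `ψ((R_I)^∼)`, `ψ'((R'_I)^∼)`) Haar
measures read through the two chosen decompositions correspond under `Φ`, since `ψ' ∘ Φ ∘ ψ⁻¹` is `ℚ_p`-linear
and carries unit polydisc to unit polydisc (`Φ((R_I)^∼) = (R'_I)^∼`). [cite: DupuyHilado2025, §4.7, Def. 3.6.1] -/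
theorem packetVol_image_factor (A : Set (PacketAlgebra p k)) :
    packetVol p k' (factorAlgEquiv p k k' φ '' A) = packetVol p k A := by
  haveI : IsModuleTopology ℚ_[p] (DSum p k) := isModuleTopologyOfFiniteDimensional
  haveI : IsModuleTopology ℚ_[p] (DSum p k') := isModuleTopologyOfFiniteDimensional
  let Ψ := (dEquiv p k).toLinearEquiv.symm.trans
    ((factorAlgEquiv p k k' φ).toLinearEquiv.trans (dEquiv p k').toLinearEquiv)
  have hΨ : Ψ '' (piUnitBallStructure (DFac p k) : Set (DSum p k)) =
      (piUnitBallStructure (DFac p k') : Set (DSum p k')) := by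
    rw [← image_normalizedPacket_eq_coe, image_conj_factor, image_normalizedPacket_factor,
      image_normalizedPacket_eq_coe]
  unfold packetVol
  rw [← image_conj_factor]
  exact PadicModule.haar_image_linearEquiv_of_image_eq p _ _ Ψ hΨ _

/-- `Φ` preserves admissibility (positive finite measure). [cite: DupuyHilado2025, Def. 3.5.1] -/
theorem packetAdm_image_factor {A : Set (PacketAlgebra p k)} (hA : PacketAdm p k A) :
    PacketAdm p k' (factorAlgEquiv p k k' φ '' A) := by
  unfold PacketAdm
  rw [packetVol_image_factor]
  exact hA

/-- … and conversely. [cite: DupuyHilado2025, Def. 3.5.1] -/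
theorem packetAdm_image_factor_iff (A : Set (PacketAlgebra p k)) :
    PacketAdm p k' (factorAlgEquiv p k k' φ '' A) ↔ PacketAdm p k A := by
  unfold PacketAdm
  rw [packetVol_image_factor]

/-- **`log μ̄'(Φ(A)) = log μ̄(A)` for EVERY subset `A`** (same measure, same degree): the chosen-decomposition
log-measure of abc-iut-c312-3's `TensorPacketMeasure` — the functional the cell's `−|log(Θ)|` numbers are built
from — depends on the packet only through the isometry classes of its factors ([IUTchIII] Prop. 3.9 (ii)
"functorial algorithm from the `𝒟^⊢`-prime-strips"). [cite: Mochizuki2012, IUTchIII Prop. 3.9 (ii) p. 116] -/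
theorem packetLogμ_image_factor (A : Set (PacketAlgebra p k)) :
    packetLogμ p k' (factorAlgEquiv p k k' φ '' A) = packetLogμ p k A := by
  have h := packetVol_image_factor p k k' φ A
  unfold packetVol at h
  simp only [packetLogμ_eq, IntegralStructure.normalizedLogVolume, IntegralStructure.logVolume, h,
    packetDegree_factor_eq p k k' φ]

/-- The inverse direction: `log μ̄(Φ⁻¹(B)) = log μ̄'(B)`. [cite: Mochizuki2012, IUTchIII Prop. 3.9 (ii) p. 116] -/
theorem packetLogμ_preimage_factor (B : Set (PacketAlgebra p k')) :
    packetLogμ p k (factorAlgEquiv p k k' φ ⁻¹' B) = packetLogμ p k' B := by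
  rw [← packetLogμ_image_factor p k k' φ, Set.image_preimage_eq _ (factorAlgEquiv p k k' φ).surjective]

/-! ## 4. Headline invariants: hull volumes, and the hull-volume of the log-shell -/

/-- **`log μ̄'(hull(Φ(S))) = log μ̄(hull(S))`** for every region `S`. [cite: Mochizuki2012, IUTchIII Prop. 3.9 (ii) p. 116]
[cite: DupuyHilado2025, §4.12] -/
theorem packetLogμ_packetHull_image_factor (S : Set (PacketAlgebra p k)) :
    packetLogμ p k' (packetHull p k' (factorAlgEquiv p k k' φ '' S)) = packetLogμ p k (packetHull p k S) := by
  rw [← image_packetHull_factor, packetLogμ_image_factor]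

/-- **The hull-volume of the log-shell is an invariant of the isometry classes of the factors**:
`log μ̄'(hull(I'_{v⃗})) = log μ̄(hull(I_{v⃗}))` (`H' = H` for the term `H = log μ̄(hull(Λ))`, `Λ = log_p(R_I^×)` up to
the scalar `(2p)^{−|I|}`, of the exact content formula). [cite: DupuyHilado2025, §4 (intro), §4.12]
[cite: Mochizuki2012, IUTchIII Prop. 3.9 (ii) p. 116] -/
theorem packetLogμ_packetHull_logShell_factor (hφ : ∀ i (x : k i), ‖φ i x‖ = ‖x‖) :
    packetLogμ p k' (packetHull p k' (logShell p k')) = packetLogμ p k (packetHull p k (logShell p k)) := by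
  rw [← image_logShell_factor p k k' φ hφ, packetLogμ_packetHull_image_factor]

/-- The same for the unscaled lattice: `log μ̄'(hull(log_p(R'_I^×))) = log μ̄(hull(log_p(R_I^×)))`.
[cite: Mochizuki2012, IUTchIV Prop. 1.2 p. 10] [cite: Mochizuki2012, IUTchIII Prop. 3.9 (ii) p. 116] -/
theorem packetLogμ_packetHull_logPacket_factor (hφ : ∀ i (x : k i), ‖φ i x‖ = ‖x‖) :
    packetLogμ p k' (packetHull p k' (logPacket p k')) = packetLogμ p k (packetHull p k (logPacket p k)) := by
  rw [← image_logPacket_factor p k k' φ hφ, packetLogμ_packetHull_image_factor]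

/-- … and for the lattices themselves: `log μ̄'(log_p(R'_I^×)) = log μ̄(log_p(R_I^×))`, `log μ̄'(I'_{v⃗}) = log μ̄(I_{v⃗})`.
[cite: Mochizuki2012, IUTchIV Prop. 1.2 p. 10] [cite: DupuyHilado2025, §4 (intro)] -/
theorem packetLogμ_logShell_factor (hφ : ∀ i (x : k i), ‖φ i x‖ = ‖x‖) :
    packetLogμ p k' (logShell p k') = packetLogμ p k (logShell p k) ∧
      packetLogμ p k' (logPacket p k') = packetLogμ p k (logPacket p k) := by
  constructor
  · rw [← image_logShell_factor p k k' φ hφ, packetLogμ_image_factor]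
  · rw [← image_logPacket_factor p k k' φ hφ, packetLogμ_image_factor]

end Volume

end Literature.IUT.LogVolume

end
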